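import Summits.ABC.ABC.Theorems.DeepRegimeABC.Negative.ConstFreeFloors

/-!
# `DeepRegimeABC` (stmt-ABC-15121): explicit floors for the constant-free threshold on the cells `ω₅ ≥ 5, 6`

Negative-side support lemmas continuing `Negative/ConstFreeFloors.lean` (floors `K₁(ε) ≥ 3, 4, 5` for
`ε ≤ 0.6299, 0.6234, 0.5221` from the Reyssat / Browkin–Brzeziński / Nitaj triples), with the
record triples of the DEEPER cells found by the exhaustive lattice census of the refuter compute
seat `ccert-stmt-ABC-15121` (2026-08-16; checker `Negative/CensusCheckerCRT.lean`, CERT.md):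

| triple | `ω₅` (deep primes) | quality | floor |
|---|---|---|---|
| `2⁷·7⁵ + 11⁶·13²·31 = 3⁶·5⁷·163` (record of the cell `ω₅ ≥ 5` below `10¹⁰`) | 5 (`2, 3, 5, 7, 11`) | `1.21838…` | `K₁(ε) ≥ 6` for `ε ≤ 0.2183` |
| `7⁶·11⁵ + 17³·19⁵·23 = 2⁶·3⁷·5⁵·683` (record of the cell `ω₅ ≥ 6` below `10¹²`) | 6 (`2, 3, 5, 7, 11, 19`) | `1.13967…` | `K₁(ε) ≥ 7` for `ε ≤ 0.1396` |
| `3¹²·5⁶ + 7⁹·31² = 2⁹·11⁵·571` (record of the cell `ω₅ ≥ 5` below `10¹¹`, kit j018870) | 5 (`2, 3, 5, 7, 11`) | `1.40218…` | `K₁(ε) ≥ 6` for `ε ≤ 0.4021` |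
| `5³·11⁸·19 + 2⁷·3⁶·17⁵·71 = 7⁶·13⁵·227` (record of the cell `ω₅ ≥ 6` below `10¹³`, kit j018870) | 6 (`2, 3, 7, 11, 13, 17`) | `1.16100…` | `K₁(ε) ≥ 7` for `ε ≤ 0.1609` |

(`ConstFreeCell(K, ε)` := "`c < rad(abc)^(1+ε)` for every abc triple with `ω₅(abc) ≥ K`"; each
record refutes it for the stated `ε` via `not_constFreeCell_of_witness`, kernel integer arithmetic for
the quality comparison.)  The cells `ω₅ ≥ 5` and `ω₅ ≥ 6` hold 51 resp. 7 abc hits below `10¹⁰` resp.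
`10¹²` (CERT.md); none below `10⁷` (`Negative/CensusBelowTenPowSeven.lean`).
-/

-- `Summit.<Summit>.<Problem>` is the mandated summit-side namespace (CONVENTIONS §2); for the
-- single-conjunct summit `ABC` the two coincide, so the duplicate `ABC.ABC` is deliberate.
set_option linter.dupNamespace false

namespace Summit.ABC.ABC.Theorems.DeepRegimeABC.Negative

open Literature.NumberTheory.DiophantineGeometry UniqueFactorizationMonoid

/-! ### Cell `ω₅ ≥ 5`: `2⁷·7⁵ + 11⁶·13²·31 = 3⁶·5⁷·163`, quality `1.21838…` -/

/-- `(2151296, 9281208079, 9283359375) = (2⁷·7⁵, 11⁶·13²·31, 3⁶·5⁷·163)` is an abc triple.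
[folklore] -/
theorem deepFiveRecord_isABCTriple :
    IsABCTriple (2 ^ 7 * 7 ^ 5) (11 ^ 6 * 13 ^ 2 * 31) (3 ^ 6 * 5 ^ 7 * 163) := by
  refine ⟨by norm_num, by norm_num, by norm_num, ?_⟩
  norm_num [Nat.coprime_iff_gcd_eq_one]

/-- Its radical is at most `2·3·5·7·11·13·31·163 = 151741590` (`abc ∣ 151741590⁷`). [folklore] -/
theorem rad_deepFiveRecord_le :
    rad (2 ^ 7 * 7 ^ 5) (11 ^ 6 * 13 ^ 2 * 31) (3 ^ 6 * 5 ^ 7 * 163) ≤ 151741590 := by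
  rw [rad_def]
  exact radical_le_of_dvd_pow (n := 7) (by norm_num) (by norm_num)

/-- Its depth count is `ω₅ ≥ 5` (`2⁷`, `7⁵`, `11⁶`, `3⁶`, `5⁷`). [folklore] -/
theorem five_le_depth_deepFiveRecord :
    5 ≤ ((2 ^ 7 * 7 ^ 5 * (11 ^ 6 * 13 ^ 2 * 31) * (3 ^ 6 * 5 ^ 7 * 163)).primeFactors.filter
      (fun p => 5 ≤ (2 ^ 7 * 7 ^ 5 * (11 ^ 6 * 13 ^ 2 * 31) *
        (3 ^ 6 * 5 ^ 7 * 163)).factorization p)).card := by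
  have hne : 2 ^ 7 * 7 ^ 5 * (11 ^ 6 * 13 ^ 2 * 31) * (3 ^ 6 * 5 ^ 7 * 163) ≠ 0 := by norm_num
  have h2 := mem_deep_of_pow_dvd hne (by norm_num : Nat.Prime 2) (by norm_num)
  have h3 := mem_deep_of_pow_dvd hne (by norm_num : Nat.Prime 3) (by norm_num)
  have h5 := mem_deep_of_pow_dvd hne (by norm_num : Nat.Prime 5) (by norm_num)
  have h7 := mem_deep_of_pow_dvd hne (by norm_num : Nat.Prime 7) (by norm_num)
  have h11 := mem_deep_of_pow_dvd hne (by norm_num : Nat.Prime 11) (by norm_num)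
  calc 5 = ({2, 3, 5, 7, 11} : Finset ℕ).card := by rfl
    _ ≤ _ := Finset.card_le_card (by
      intro p hp
      simp only [Finset.mem_insert, Finset.mem_singleton] at hp
      rcases hp with rfl | rfl | rfl | rfl | rfl <;> assumption)

set_option exponentiation.threshold 20000 in
/-- `151741590^12183 < (3⁶·5⁷·163)^10000`, i.e. quality `> 1.2183` (kernel integer arithmetic).
[folklore] -/
theorem deepFiveRecord_pow_lt : (151741590 : ℕ) ^ 12183 < (3 ^ 6 * 5 ^ 7 * 163) ^ 10000 := by
  decide

/-- **`K₁(ε) ≥ 6` for `ε ≤ 0.2183`**: the record triple of the cell `ω₅ ≥ 5` below `10¹⁰` (quality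
`> 1.2183`) refutes the constant-free statement on the cell `{ω₅ ≥ 5}`. [folklore] -/
theorem not_constFreeCell_five {ε : ℝ} (hε : ε ≤ 0.2183) :
    ¬ ∀ a b c : ℕ, IsABCTriple a b c →
        5 ≤ ((a * b * c).primeFactors.filter (fun p => 5 ≤ (a * b * c).factorization p)).card →
        (c : ℝ) < ((rad a b c : ℕ) : ℝ) ^ (1 + ε) := by
  refine not_constFreeCell_of_witness (R := 151741590) (P := 12183) (Q := 10000)
    deepFiveRecord_isABCTriple five_le_depth_deepFiveRecord rad_deepFiveRecord_le (by norm_num)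
    (by norm_num) deepFiveRecord_pow_lt ?_
  norm_num at hε ⊢; linarith

/-! ### Cell `ω₅ ≥ 6`: `7⁶·11⁵ + 17³·19⁵·23 = 2⁶·3⁷·5⁵·683`, quality `1.13967…` -/

/-- `(18947489099, 279796710901, 298744200000) = (7⁶·11⁵, 17³·19⁵·23, 2⁶·3⁷·5⁵·683)` is an abc
triple. [folklore] -/
theorem deepSixRecord_isABCTriple :
    IsABCTriple (7 ^ 6 * 11 ^ 5) (17 ^ 3 * 19 ^ 5 * 23) (2 ^ 6 * 3 ^ 7 * 5 ^ 5 * 683) := by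
  refine ⟨by norm_num, by norm_num, by norm_num, ?_⟩
  norm_num [Nat.coprime_iff_gcd_eq_one]

/-- Its radical is at most `2·3·5·7·11·17·19·23·683 = 11720956170` (`abc ∣ 11720956170⁷`).
[folklore] -/
theorem rad_deepSixRecord_le :
    rad (7 ^ 6 * 11 ^ 5) (17 ^ 3 * 19 ^ 5 * 23) (2 ^ 6 * 3 ^ 7 * 5 ^ 5 * 683) ≤ 11720956170 := by
  rw [rad_def]
  exact radical_le_of_dvd_pow (n := 7) (by norm_num) (by norm_num)

/-- Its depth count is `ω₅ ≥ 6` (`7⁶`, `11⁵`, `19⁵`, `2⁶`, `3⁷`, `5⁵`). [folklore] -/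
theorem six_le_depth_deepSixRecord :
    6 ≤ ((7 ^ 6 * 11 ^ 5 * (17 ^ 3 * 19 ^ 5 * 23) * (2 ^ 6 * 3 ^ 7 * 5 ^ 5 * 683)).primeFactors.filter
      (fun p => 5 ≤ (7 ^ 6 * 11 ^ 5 * (17 ^ 3 * 19 ^ 5 * 23) *
        (2 ^ 6 * 3 ^ 7 * 5 ^ 5 * 683)).factorization p)).card := by
  have hne : 7 ^ 6 * 11 ^ 5 * (17 ^ 3 * 19 ^ 5 * 23) * (2 ^ 6 * 3 ^ 7 * 5 ^ 5 * 683) ≠ 0 := by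
    norm_num
  have h2 := mem_deep_of_pow_dvd hne (by norm_num : Nat.Prime 2) (by norm_num)
  have h3 := mem_deep_of_pow_dvd hne (by norm_num : Nat.Prime 3) (by norm_num)
  have h5 := mem_deep_of_pow_dvd hne (by norm_num : Nat.Prime 5) (by norm_num)
  have h7 := mem_deep_of_pow_dvd hne (by norm_num : Nat.Prime 7) (by norm_num)
  have h11 := mem_deep_of_pow_dvd hne (by norm_num : Nat.Prime 11) (by norm_num)
  have h19 := mem_deep_of_pow_dvd hne (by norm_num : Nat.Prime 19) (by norm_num)
  calc 6 = ({2, 3, 5, 7, 11, 19} : Finset ℕ).card := by rfl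
    _ ≤ _ := Finset.card_le_card (by
      intro p hp
      simp only [Finset.mem_insert, Finset.mem_singleton] at hp
      rcases hp with rfl | rfl | rfl | rfl | rfl | rfl <;> assumption)

set_option exponentiation.threshold 20000 in
/-- `11720956170^11396 < (2⁶·3⁷·5⁵·683)^10000`, i.e. quality `> 1.1396` (kernel integer
arithmetic). [folklore] -/
theorem deepSixRecord_pow_lt :
    (11720956170 : ℕ) ^ 11396 < (2 ^ 6 * 3 ^ 7 * 5 ^ 5 * 683) ^ 10000 := by
  decide

/-- **`K₁(ε) ≥ 7` for `ε ≤ 0.1396`**: the record triple of the cell `ω₅ ≥ 6` below `10¹²` (quality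
`> 1.1396`) refutes the constant-free statement on the cell `{ω₅ ≥ 6}`. [folklore] -/
theorem not_constFreeCell_six {ε : ℝ} (hε : ε ≤ 0.1396) :
    ¬ ∀ a b c : ℕ, IsABCTriple a b c →
        6 ≤ ((a * b * c).primeFactors.filter (fun p => 5 ≤ (a * b * c).factorization p)).card →
        (c : ℝ) < ((rad a b c : ℕ) : ℝ) ^ (1 + ε) := by
  refine not_constFreeCell_of_witness (R := 11720956170) (P := 11396) (Q := 10000)
    deepSixRecord_isABCTriple six_le_depth_deepSixRecord rad_deepSixRecord_le (by norm_num)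
    (by norm_num) deepSixRecord_pow_lt ?_
  norm_num at hε ⊢; linarith

/-- **Reading for the crux: every admissible constant-free threshold is `≥ 6` at `ε ≤ 0.2183` and
`≥ 7` at `ε ≤ 0.1396`.** [folklore] -/
theorem constFree_threshold_ge_six {ε : ℝ} (hε : ε ≤ 0.2183) {K : ℕ}
    (h : ∀ a b c : ℕ, IsABCTriple a b c →
        K ≤ ((a * b * c).primeFactors.filter (fun p => 5 ≤ (a * b * c).factorization p)).card →
        (c : ℝ) < ((rad a b c : ℕ) : ℝ) ^ (1 + ε)) :
    6 ≤ K := by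
  by_contra hK
  exact not_constFreeCell_five hε (constFreeCell_mono (by omega) h)

/-- See `constFree_threshold_ge_six`. [folklore] -/
theorem constFree_threshold_ge_seven {ε : ℝ} (hε : ε ≤ 0.1396) {K : ℕ}
    (h : ∀ a b c : ℕ, IsABCTriple a b c →
        K ≤ ((a * b * c).primeFactors.filter (fun p => 5 ≤ (a * b * c).factorization p)).card →
        (c : ℝ) < ((rad a b c : ℕ) : ℝ) ^ (1 + ε)) :
    7 ≤ K := by
  by_contra hK
  exact not_constFreeCell_six hε (constFreeCell_mono (by omega) h)

/-! ### Cell `ω₅ ≥ 5`, window `10¹¹` (kit j018870): `3¹²·5⁶ + 7⁹·31² = 2⁹·11⁵·571`, quality `1.40218…` -/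

/-- `(8303765625, 38779816327, 47083581952) = (3¹²·5⁶, 7⁹·31², 2⁹·11⁵·571)` is an abc triple
(record of the cell `ω₅ ≥ 5` below `10¹¹`; deep_census.py, kit j018870). [folklore] -/
theorem deepFiveRecord11_isABCTriple :
    IsABCTriple (3 ^ 12 * 5 ^ 6) (7 ^ 9 * 31 ^ 2) (2 ^ 9 * 11 ^ 5 * 571) := by
  refine ⟨by norm_num, by norm_num, by norm_num, ?_⟩
  norm_num [Nat.coprime_iff_gcd_eq_one]

/-- Its radical is at most `2·3·5·7·11·31·571 = 40889310` (`abc ∣ 40889310¹²`). [folklore] -/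
theorem rad_deepFiveRecord11_le :
    rad (3 ^ 12 * 5 ^ 6) (7 ^ 9 * 31 ^ 2) (2 ^ 9 * 11 ^ 5 * 571) ≤ 40889310 := by
  rw [rad_def]
  exact radical_le_of_dvd_pow (n := 12) (by norm_num) (by norm_num)

/-- Its depth count is `ω₅ ≥ 5` (`3¹²`, `5⁶`, `7⁹`, `2⁹`, `11⁵`). [folklore] -/
theorem five_le_depth_deepFiveRecord11 :
    5 ≤ ((3 ^ 12 * 5 ^ 6 * (7 ^ 9 * 31 ^ 2) * (2 ^ 9 * 11 ^ 5 * 571)).primeFactors.filter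
      (fun p => 5 ≤ (3 ^ 12 * 5 ^ 6 * (7 ^ 9 * 31 ^ 2) *
        (2 ^ 9 * 11 ^ 5 * 571)).factorization p)).card := by
  have hne : 3 ^ 12 * 5 ^ 6 * (7 ^ 9 * 31 ^ 2) * (2 ^ 9 * 11 ^ 5 * 571) ≠ 0 := by norm_num
  have h2 := mem_deep_of_pow_dvd hne (by norm_num : Nat.Prime 2) (by norm_num)
  have h3 := mem_deep_of_pow_dvd hne (by norm_num : Nat.Prime 3) (by norm_num)
  have h5 := mem_deep_of_pow_dvd hne (by norm_num : Nat.Prime 5) (by norm_num)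
  have h7 := mem_deep_of_pow_dvd hne (by norm_num : Nat.Prime 7) (by norm_num)
  have h11 := mem_deep_of_pow_dvd hne (by norm_num : Nat.Prime 11) (by norm_num)
  calc 5 = ({2, 3, 5, 7, 11} : Finset ℕ).card := by rfl
    _ ≤ _ := Finset.card_le_card (by
      intro p hp
      simp only [Finset.mem_insert, Finset.mem_singleton] at hp
      rcases hp with rfl | rfl | rfl | rfl | rfl <;> assumption)

set_option exponentiation.threshold 20000 in
/-- `40889310^14021 < (2⁹·11⁵·571)^10000`, i.e. quality `> 1.4021` (kernel integer arithmetic).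
[folklore] -/
theorem deepFiveRecord11_pow_lt : (40889310 : ℕ) ^ 14021 < (2 ^ 9 * 11 ^ 5 * 571) ^ 10000 := by
  decide

/-- **`K₁(ε) ≥ 6` for `ε ≤ 0.4021`** (supersedes `not_constFreeCell_five`): the record triple of the
cell `ω₅ ≥ 5` below `10¹¹` (quality `> 1.4021`) refutes the constant-free statement on `{ω₅ ≥ 5}`.
[folklore] -/
theorem not_constFreeCell_five' {ε : ℝ} (hε : ε ≤ 0.4021) :
    ¬ ∀ a b c : ℕ, IsABCTriple a b c →
        5 ≤ ((a * b * c).primeFactors.filter (fun p => 5 ≤ (a * b * c).factorization p)).card →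
        (c : ℝ) < ((rad a b c : ℕ) : ℝ) ^ (1 + ε) := by
  refine not_constFreeCell_of_witness (R := 40889310) (P := 14021) (Q := 10000)
    deepFiveRecord11_isABCTriple five_le_depth_deepFiveRecord11 rad_deepFiveRecord11_le
    (by norm_num) (by norm_num) deepFiveRecord11_pow_lt ?_
  norm_num at hε ⊢; linarith

/-! ### Cell `ω₅ ≥ 6`, window `10¹³` (kit j018870): `5³·11⁸·19 + 2⁷·3⁶·17⁵·71 = 7⁶·13⁵·227`, quality `1.16100…` -/

/-- `(509102342375, 9406768443264, 9915870785639) = (5³·11⁸·19, 2⁷·3⁶·17⁵·71, 7⁶·13⁵·227)` is an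
abc triple (record of the cell `ω₅ ≥ 6` below `10¹³`; deep_census.py, kit j018870). [folklore] -/
theorem deepSixRecord13_isABCTriple :
    IsABCTriple (5 ^ 3 * 11 ^ 8 * 19) (2 ^ 7 * 3 ^ 6 * 17 ^ 5 * 71) (7 ^ 6 * 13 ^ 5 * 227) := by
  refine ⟨by norm_num, by norm_num, by norm_num, ?_⟩
  norm_num [Nat.coprime_iff_gcd_eq_one]

/-- Its radical is at most `2·3·5·7·11·13·17·19·71·227 = 156329903730` (`abc ∣ 156329903730⁸`).
[folklore] -/
theorem rad_deepSixRecord13_le :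
    rad (5 ^ 3 * 11 ^ 8 * 19) (2 ^ 7 * 3 ^ 6 * 17 ^ 5 * 71) (7 ^ 6 * 13 ^ 5 * 227) ≤ 156329903730 := by
  rw [rad_def]
  exact radical_le_of_dvd_pow (n := 8) (by norm_num) (by norm_num)

/-- Its depth count is `ω₅ ≥ 6` (`11⁸`, `2⁷`, `3⁶`, `17⁵`, `7⁶`, `13⁵`). [folklore] -/
theorem six_le_depth_deepSixRecord13 :
    6 ≤ ((5 ^ 3 * 11 ^ 8 * 19 * (2 ^ 7 * 3 ^ 6 * 17 ^ 5 * 71) * (7 ^ 6 * 13 ^ 5 * 227)).primeFactors.filter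
      (fun p => 5 ≤ (5 ^ 3 * 11 ^ 8 * 19 * (2 ^ 7 * 3 ^ 6 * 17 ^ 5 * 71) *
        (7 ^ 6 * 13 ^ 5 * 227)).factorization p)).card := by
  have hne : 5 ^ 3 * 11 ^ 8 * 19 * (2 ^ 7 * 3 ^ 6 * 17 ^ 5 * 71) * (7 ^ 6 * 13 ^ 5 * 227) ≠ 0 := by
    norm_num
  have h2 := mem_deep_of_pow_dvd hne (by norm_num : Nat.Prime 2) (by norm_num)
  have h3 := mem_deep_of_pow_dvd hne (by norm_num : Nat.Prime 3) (by norm_num)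
  have h7 := mem_deep_of_pow_dvd hne (by norm_num : Nat.Prime 7) (by norm_num)
  have h11 := mem_deep_of_pow_dvd hne (by norm_num : Nat.Prime 11) (by norm_num)
  have h13 := mem_deep_of_pow_dvd hne (by norm_num : Nat.Prime 13) (by norm_num)
  have h17 := mem_deep_of_pow_dvd hne (by norm_num : Nat.Prime 17) (by norm_num)
  calc 6 = ({2, 3, 7, 11, 13, 17} : Finset ℕ).card := by rfl
    _ ≤ _ := Finset.card_le_card (by
      intro p hp
      simp only [Finset.mem_insert, Finset.mem_singleton] at hp
      rcases hp with rfl | rfl | rfl | rfl | rfl | rfl <;> assumption)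

set_option exponentiation.threshold 20000 in
/-- `156329903730^11609 < (7⁶·13⁵·227)^10000`, i.e. quality `> 1.1609` (kernel integer arithmetic).
[folklore] -/
theorem deepSixRecord13_pow_lt :
    (156329903730 : ℕ) ^ 11609 < (7 ^ 6 * 13 ^ 5 * 227) ^ 10000 := by
  decide

/-- **`K₁(ε) ≥ 7` for `ε ≤ 0.1609`** (supersedes `not_constFreeCell_six`): the record triple of the
cell `ω₅ ≥ 6` below `10¹³` (quality `> 1.1609`) refutes the constant-free statement on `{ω₅ ≥ 6}`.
[folklore] -/
theorem not_constFreeCell_six' {ε : ℝ} (hε : ε ≤ 0.1609) :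
    ¬ ∀ a b c : ℕ, IsABCTriple a b c →
        6 ≤ ((a * b * c).primeFactors.filter (fun p => 5 ≤ (a * b * c).factorization p)).card →
        (c : ℝ) < ((rad a b c : ℕ) : ℝ) ^ (1 + ε) := by
  refine not_constFreeCell_of_witness (R := 156329903730) (P := 11609) (Q := 10000)
    deepSixRecord13_isABCTriple six_le_depth_deepSixRecord13 rad_deepSixRecord13_le
    (by norm_num) (by norm_num) deepSixRecord13_pow_lt ?_
  norm_num at hε ⊢; linarith

/-- **Every admissible constant-free threshold is `≥ 6` at `ε ≤ 0.4021` and `≥ 7` at `ε ≤ 0.1609`.**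
[folklore] -/
theorem constFree_threshold_ge_six' {ε : ℝ} (hε : ε ≤ 0.4021) {K : ℕ}
    (h : ∀ a b c : ℕ, IsABCTriple a b c →
        K ≤ ((a * b * c).primeFactors.filter (fun p => 5 ≤ (a * b * c).factorization p)).card →
        (c : ℝ) < ((rad a b c : ℕ) : ℝ) ^ (1 + ε)) :
    6 ≤ K := by
  by_contra hK
  exact not_constFreeCell_five' hε (constFreeCell_mono (by omega) h)

/-- See `constFree_threshold_ge_six'`. [folklore] -/
theorem constFree_threshold_ge_seven' {ε : ℝ} (hε : ε ≤ 0.1609) {K : ℕ}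
    (h : ∀ a b c : ℕ, IsABCTriple a b c →
        K ≤ ((a * b * c).primeFactors.filter (fun p => 5 ≤ (a * b * c).factorization p)).card →
        (c : ℝ) < ((rad a b c : ℕ) : ℝ) ^ (1 + ε)) :
    7 ≤ K := by
  by_contra hK
  exact not_constFreeCell_six' hε (constFreeCell_mono (by omega) h)

end Summit.ABC.ABC.Theorems.DeepRegimeABC.Negative
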